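import Summits.QuantumFields.YangMills.Theses.ParabolicTrajectory

/-!
# `BalabanStepParabolic` — negative-side support II: what every inhabitant forces (transport, orbit length, corner)

Support file for crux `stmt-QuantumFields-9684` (`ParabolicTrajectory.BalabanStepParabolic`), extracted from the
standing disprover's work file `Cruxes/BalabanStepParabolic/Disproof.lean` §T, §L, §C (cycle 2). Theorems about an
ARBITRARY inhabitant `S : BalabanBanachStep G r M`; tree objects only, no definitions.

* §T `expect_orbit_wilson`: at depth `k` of the orbit of the Wilson point `(g, yW g)` (in the chart for `k` steps)
  the realisation functional on the torus `2L+1` IS Wilson's centred `n`-point function at `β = betaOf g` on the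
  torus `2L'+1 = M^k(2L+1)` with `k`-fold block-dilated test functions (`pow_mul_odd_eq`: such `L'` exists for
  every `k` iff `M` is odd). `tendsto_wilson_of_tendsto_orbit`: an in-chart CONVERGENT sequence of such orbit
  points forces convergence of those genuine Wilson data (off-diagonal tuples) — a joint continuum /
  thermodynamic-limit statement along the inhabitant's own tuning. This is the content (4c) carries at odd `M`.
* §L `orbit_mem_chart`, `orbit_hyp`, `wilson_data_in_chart`: with `c₁ = b + C(δ+R)` and the explicit threshold
  `gₛ = min δ (min √(1/(2c₁)) √((1−θ′)R/C))`, the Wilson orbit from coupling `g ∈ (0, min gₛ g₀]` stays in the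
  chart with `1/g_j² ≥ 1/g² − 2c₁ j` for all `j ≤ k` whenever `2c₁k ≤ 1/g² − 1/gₛ²`: the pinned tori
  `M^k(2L+1)` have `k` linear in `betaOf g ≈ κ/g²`, i.e. sides EXPONENTIAL in `β`. No inhabitant can eject
  Wilson points from the chart in `O(1)` steps.
* §C `tendsto_wilson_corner`, `atTop_le_map_betaOf`, `tendsto_curvCorr_atTop`: continuity at the corner
  `(0, yW 0)` forces the genuine centred plaquette `n`-point functions on every FIXED odd torus to converge as
  `β → ∞` (true, limit `0` for `n ≥ 1` — a near-miss, not a kill).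
-/

namespace Summit.QuantumFields.YangMills.Theorems.BalabanStepParabolic.Negative

open scoped SchwartzMap
open MeasureTheory Filter Topology
open Literature.MathematicalPhysics.QuantumFieldTheory Literature.MathematicalPhysics.AQFT
open Literature.MathematicalPhysics.QuantumLattice

noncomputable section

variable {G : Type} [Group G] [TopologicalSpace G] [IsTopologicalGroup G] [CompactSpace G]
  [MeasurableSpace G] [BorelSpace G] {r : LatticeRep G} {M : ℕ} (S : BalabanBanachStep G r M)


/-! ### §T  Transport: in-chart orbit points of Wilson points carry genuine dilated Wilson data -/

/-- Odd block factors keep odd tori odd: `M^k (2L+1) = 2 L' + 1` with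
`L' = (M^k (2L+1) - 1)/2`. [folklore] -/
theorem pow_mul_odd_eq (hM : Odd M) (k L : ℕ) :
    M ^ k * (2 * L + 1) = 2 * ((M ^ k * (2 * L + 1) - 1) / 2) + 1 := by
  have hodd : Odd (M ^ k * (2 * L + 1)) := (hM.pow).mul ⟨L, rfl⟩
  obtain ⟨m, hm⟩ := hodd
  omega

/-- **Transport theorem.** At the `k`-th step of the orbit of the Wilson point `(g, yW g)`
(`g ∈ (0, g₀]`, orbit in the chart for `k` steps) the realisation functional on the odd torus
`2L+1` IS the genuine centred Wilson `n`-point function at inverse coupling `betaOf g` on the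
torus `2L'+1 = M^k (2L+1)` with `k`-fold block-dilated test functions — for odd `M` (where such
`L'` exists for every `k`, `pow_mul_odd_eq`) nothing in the structure is free there. [folklore] -/
theorem expect_orbit_wilson {g : ℝ} (hg : g ∈ Set.Ioc 0 S.g₀) (k : ℕ)
    (hk : ∀ i < k, (S.F^[i] (g, S.yW g)).1 ∈ Set.Icc 0 S.δ ∧ ‖(S.F^[i] (g, S.yW g)).2‖ ≤ S.R)
    (L L' n : ℕ) (hL : M ^ k * (2 * L + 1) = 2 * L' + 1) (σ : Fin n → YMSpecies G)
    (f : Fin n → 𝓢(EuclideanSpace ℝ (Fin 4), ℝ)) :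
    S.expect (S.F^[k] (g, S.yW g)) (2 * L + 1) n σ f =
      wilsonCentredSchwinger r.ρ (S.betaOf g) L' (S.c g) n σ
        (fun i => (blockDilate M)^[k] (f i)) := by
  rw [S.expect_iterate (g, S.yW g) k hk (2 * L + 1) n σ f, hL, S.expect_wilson g hg]

/-- **Accumulation ⇒ continuum-type convergence.** If a sequence of in-chart orbit points of
Wilson points converges IN THE CHART, then (odd `M`, off-diagonal tuple) the corresponding genuine
Wilson data — at inverse couplings `betaOf g_j`, on tori `M^{k_j}(2L+1)`, with `k_j`-fold dilated
test functions — converge (to the value of `expect` at the limit point). With `k_j → ∞`,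
`g_j → 0⁺` this is a joint continuum/thermodynamic limit statement along the inhabitant's own
tuning `β_j = betaOf g_j`: the content (4c) carries for odd `M`. [folklore] -/
theorem tendsto_wilson_of_tendsto_orbit (hM : Odd M) {g : ℕ → ℝ} {k : ℕ → ℕ}
    (hg : ∀ j, g j ∈ Set.Ioc 0 S.g₀)
    (hk : ∀ j, ∀ i ≤ k j, (S.F^[i] (g j, S.yW (g j))).1 ∈ Set.Icc 0 S.δ ∧
      ‖(S.F^[i] (g j, S.yW (g j))).2‖ ≤ S.R)
    {q : ℝ × S.E} (hq : q ∈ Set.Icc 0 S.δ ×ˢ Metric.closedBall (0 : S.E) S.R)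
    (hconv : Tendsto (fun j => S.F^[k j] (g j, S.yW (g j))) atTop (𝓝 q))
    (L n : ℕ) (σ : Fin n → YMSpecies G) (f : Fin n → 𝓢(EuclideanSpace ℝ (Fin 4), ℝ))
    (hf : IsOffDiagonal (SchwartzMap.tensorFin n fun i => ofRealTest (f i))) :
    Tendsto (fun j => wilsonCentredSchwinger r.ρ (S.betaOf (g j))
        ((M ^ (k j) * (2 * L + 1) - 1) / 2) (S.c (g j)) n σ
        (fun i => (blockDilate M)^[k j] (f i))) atTop (𝓝 (S.expect q (2 * L + 1) n σ f)) := by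
  have hmem : ∀ j, S.F^[k j] (g j, S.yW (g j)) ∈
      Set.Icc 0 S.δ ×ˢ Metric.closedBall (0 : S.E) S.R := fun j => by
    have h := hk j (k j) le_rfl
    exact Set.mk_mem_prod h.1 (by simpa [Metric.mem_closedBall, dist_zero_right] using h.2)
  have hcont := S.continuousOn_expect (2 * L + 1) n σ f hf q hq
  have h1 : Tendsto (fun j => S.F^[k j] (g j, S.yW (g j))) atTop
      (𝓝[Set.Icc 0 S.δ ×ˢ Metric.closedBall (0 : S.E) S.R] q) :=
    tendsto_nhdsWithin_iff.2 ⟨hconv, Eventually.of_forall hmem⟩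
  have h2 := hcont.tendsto.comp h1
  refine h2.congr fun j => ?_
  simp only [Function.comp_apply]
  exact expect_orbit_wilson S (hg j) (k j) (fun i hi => hk j i hi.le) L _ n
    (pow_mul_odd_eq hM (k j) L) σ f

/-! ### §L  Orbit length: Wilson orbits stay in the chart for ≳ 1/(2c₁g²) steps -/

/-- The cubic growth constant `c₁ = b + C(δ + R)` is positive. [folklore] -/
theorem c₁_pos : 0 < (S.b + S.C * (S.δ + S.R)) := by
  have := S.b_pos; have := S.C_pos; have := S.δ_pos; have := S.R_pos
  positivity

/-- On the basin the coupling moves by at most `c₁ g³` per step. [folklore] -/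
theorem abs_φ_sub_self_le {g : ℝ} {y : S.E} (hg0 : 0 ≤ g) (hg : g ≤ S.δ) (hy : ‖y‖ ≤ S.R) :
    |S.φ g y - g| ≤ (S.b + S.C * (S.δ + S.R)) * g ^ 3 := by
  have habs : |g| ≤ S.δ := by rwa [abs_of_nonneg hg0]
  have h := S.abs_φ_sub_le habs hy
  rw [abs_of_nonneg hg0] at h
  have hC := S.C_pos.le
  have hg4 : g ^ 4 ≤ S.δ * g ^ 3 := by nlinarith [pow_nonneg hg0 3]
  calc |S.φ g y - g| ≤ S.b * g ^ 3 + S.C * (g ^ 4 + g ^ 3 * S.R) := h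
    _ ≤ S.b * g ^ 3 + S.C * (S.δ * g ^ 3 + g ^ 3 * S.R) := by gcongr
    _ = (S.b + S.C * (S.δ + S.R)) * g ^ 3 := by ring

/-- Elementary: if `0 < g' ≤ g + c g³` (`c ≥ 0`, `g > 0`) then `1/g'² ≥ 1/g² − 2c`. [folklore] -/
theorem inv_sq_step {g g' c : ℝ} (hg : 0 < g) (hg' : 0 < g') (hc : 0 ≤ c)
    (h : g' ≤ g + c * g ^ 3) : 1 / g ^ 2 - 2 * c ≤ 1 / g' ^ 2 := by
  have hx : 0 ≤ c * g ^ 2 := by positivity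
  -- (1 - 2x)(1 + x)^2 ≤ 1 with x = c g²
  have key : (1 - 2 * (c * g ^ 2)) * (1 + c * g ^ 2) ^ 2 ≤ 1 := by
    nlinarith [sq_nonneg (c * g ^ 2), mul_nonneg hx (sq_nonneg (c * g ^ 2))]
  have hg'le : g' ≤ g * (1 + c * g ^ 2) := by nlinarith
  have hpos : 0 < g * (1 + c * g ^ 2) := by positivity
  have h1 : 1 / (g * (1 + c * g ^ 2)) ^ 2 ≤ 1 / g' ^ 2 := by
    apply one_div_le_one_div_of_le (by positivity)
    exact pow_le_pow_left₀ hg'.le hg'le 2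
  refine le_trans ?_ h1
  have e1 : 1 / g ^ 2 - 2 * c = (1 - 2 * (c * g ^ 2)) / g ^ 2 := by
    field_simp
  rw [e1, div_le_div_iff₀ (by positivity) (by positivity), one_mul]
  calc (1 - 2 * (c * g ^ 2)) * (g * (1 + c * g ^ 2)) ^ 2
      = g ^ 2 * ((1 - 2 * (c * g ^ 2)) * (1 + c * g ^ 2) ^ 2) := by ring
    _ ≤ g ^ 2 * 1 := by gcongr
    _ = g ^ 2 := mul_one _

/-- The smallness threshold `gₛ = min δ (min √(1/(2c₁)) √((1−θ′)R/C))` is positive. [folklore] -/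
theorem gₛ_pos : 0 < (min S.δ (min (Real.sqrt (1 / (2 * (S.b + S.C * (S.δ + S.R))))) (Real.sqrt ((1 - S.θ') * S.R / S.C)))) := by
  have h1 := S.δ_pos; have h2 := (c₁_pos S); have h3 := S.C_pos; have h4 := S.R_pos
  have h5 : 0 < 1 - S.θ' := by linarith [S.θ'_lt_one]
  refine lt_min h1 (lt_min (Real.sqrt_pos.2 (by positivity)) (Real.sqrt_pos.2 (by positivity)))

/-- `gₛ ≤ δ`. [folklore] -/
theorem gₛ_le_δ : (min S.δ (min (Real.sqrt (1 / (2 * (S.b + S.C * (S.δ + S.R))))) (Real.sqrt ((1 - S.θ') * S.R / S.C)))) ≤ S.δ := min_le_left _ _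

/-- `c₁ gₛ² ≤ 1/2`. [folklore] -/
theorem c₁_mul_gₛ_sq : (S.b + S.C * (S.δ + S.R)) * (min S.δ (min (Real.sqrt (1 / (2 * (S.b + S.C * (S.δ + S.R))))) (Real.sqrt ((1 - S.θ') * S.R / S.C)))) ^ 2 ≤ 1 / 2 := by
  have h2 := (c₁_pos S)
  have hle : (min S.δ (min (Real.sqrt (1 / (2 * (S.b + S.C * (S.δ + S.R))))) (Real.sqrt ((1 - S.θ') * S.R / S.C)))) ≤ Real.sqrt (1 / (2 * (S.b + S.C * (S.δ + S.R)))) := (min_le_right _ _).trans (min_le_left _ _)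
  have hsq : (min S.δ (min (Real.sqrt (1 / (2 * (S.b + S.C * (S.δ + S.R))))) (Real.sqrt ((1 - S.θ') * S.R / S.C)))) ^ 2 ≤ 1 / (2 * (S.b + S.C * (S.δ + S.R))) := by
    calc (min S.δ (min (Real.sqrt (1 / (2 * (S.b + S.C * (S.δ + S.R))))) (Real.sqrt ((1 - S.θ') * S.R / S.C)))) ^ 2 ≤ (Real.sqrt (1 / (2 * (S.b + S.C * (S.δ + S.R))))) ^ 2 := pow_le_pow_left₀ (gₛ_pos S).le hle 2
      _ = 1 / (2 * (S.b + S.C * (S.δ + S.R))) := Real.sq_sqrt (by positivity)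
  calc (S.b + S.C * (S.δ + S.R)) * (min S.δ (min (Real.sqrt (1 / (2 * (S.b + S.C * (S.δ + S.R))))) (Real.sqrt ((1 - S.θ') * S.R / S.C)))) ^ 2 ≤ (S.b + S.C * (S.δ + S.R)) * (1 / (2 * (S.b + S.C * (S.δ + S.R)))) := by gcongr
    _ = 1 / 2 := by field_simp

/-- `C gₛ² ≤ (1 − θ′) R`. [folklore] -/
theorem C_mul_gₛ_sq : S.C * (min S.δ (min (Real.sqrt (1 / (2 * (S.b + S.C * (S.δ + S.R))))) (Real.sqrt ((1 - S.θ') * S.R / S.C)))) ^ 2 ≤ (1 - S.θ') * S.R := by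
  have h3 := S.C_pos; have h4 := S.R_pos
  have h5 : 0 < 1 - S.θ' := by linarith [S.θ'_lt_one]
  have hle : (min S.δ (min (Real.sqrt (1 / (2 * (S.b + S.C * (S.δ + S.R))))) (Real.sqrt ((1 - S.θ') * S.R / S.C)))) ≤ Real.sqrt ((1 - S.θ') * S.R / S.C) :=
    (min_le_right _ _).trans (min_le_right _ _)
  have hsq : (min S.δ (min (Real.sqrt (1 / (2 * (S.b + S.C * (S.δ + S.R))))) (Real.sqrt ((1 - S.θ') * S.R / S.C)))) ^ 2 ≤ (1 - S.θ') * S.R / S.C := by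
    calc (min S.δ (min (Real.sqrt (1 / (2 * (S.b + S.C * (S.δ + S.R))))) (Real.sqrt ((1 - S.θ') * S.R / S.C)))) ^ 2 ≤ (Real.sqrt ((1 - S.θ') * S.R / S.C)) ^ 2 := pow_le_pow_left₀ (gₛ_pos S).le hle 2
      _ = (1 - S.θ') * S.R / S.C := Real.sq_sqrt (by positivity)
  calc S.C * (min S.δ (min (Real.sqrt (1 / (2 * (S.b + S.C * (S.δ + S.R))))) (Real.sqrt ((1 - S.θ') * S.R / S.C)))) ^ 2 ≤ S.C * ((1 - S.θ') * S.R / S.C) := by gcongr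
    _ = (1 - S.θ') * S.R := by field_simp

/-- **Orbit-length theorem .** For a Wilson coupling `g ∈ (0, min gₛ g₀]` the orbit
of `(g, yW g)` stays in the chart, with positive coupling `≤ gₛ` and `1/g_j² ≥ 1/g² − 2 c₁ j`,
for every `j ≤ k` as long as `2 c₁ k ≤ 1/g² − 1/gₛ²`.  So the number of in-chart steps is at
least `(1/g² − 1/gₛ²)/(2c₁) ≈ betaOf g /(2 c₁ κ)`: LINEAR in the inverse bare coupling, i.e. the
pinned tori `M^k (2L+1)` reach sizes EXPONENTIAL in `β`. [folklore] -/
theorem orbit_mem_chart {g : ℝ} (hg0 : 0 < g) (hgs : g ≤ (min S.δ (min (Real.sqrt (1 / (2 * (S.b + S.C * (S.δ + S.R))))) (Real.sqrt ((1 - S.θ') * S.R / S.C))))) (hg₀ : g ≤ S.g₀) (k : ℕ)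
    (hk : 2 * (S.b + S.C * (S.δ + S.R)) * k ≤ 1 / g ^ 2 - 1 / (min S.δ (min (Real.sqrt (1 / (2 * (S.b + S.C * (S.δ + S.R))))) (Real.sqrt ((1 - S.θ') * S.R / S.C)))) ^ 2) :
    ∀ j ≤ k, 0 < (S.F^[j] (g, S.yW g)).1 ∧ (S.F^[j] (g, S.yW g)).1 ≤ (min S.δ (min (Real.sqrt (1 / (2 * (S.b + S.C * (S.δ + S.R))))) (Real.sqrt ((1 - S.θ') * S.R / S.C)))) ∧
      ‖(S.F^[j] (g, S.yW g)).2‖ ≤ S.R ∧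
      1 / g ^ 2 - 2 * (S.b + S.C * (S.δ + S.R)) * j ≤ 1 / (S.F^[j] (g, S.yW g)).1 ^ 2 := by
  intro j hj
  induction j with
  | zero =>
    simp only [Function.iterate_zero, id_eq, CharP.cast_eq_zero, mul_zero, sub_zero, le_refl,
      and_true]
    exact ⟨hg0, hgs, S.norm_yW_le g ⟨hg0.le, hg₀⟩⟩
  | succ j ih =>
    obtain ⟨hpos, hle, hy, hinv⟩ := ih (Nat.le_of_succ_le hj)
    set q := S.F^[j] (g, S.yW g) with hq
    have hstep : S.F^[j + 1] (g, S.yW g) = (S.φ q.1 q.2, S.Ψ q.1 q.2) := by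
      rw [Function.iterate_succ_apply', hq]; rfl
    rw [hstep]
    simp only
    have hqδ : q.1 ≤ S.δ := hle.trans (gₛ_le_δ S)
    have habs : |q.1| ≤ S.δ := by rwa [abs_of_pos hpos]
    have hφ := (abs_φ_sub_self_le S) hpos.le hqδ hy
    have hc₁ := (c₁_pos S)
    have hq2 : (S.b + S.C * (S.δ + S.R)) * q.1 ^ 2 ≤ 1 / 2 := by
      calc (S.b + S.C * (S.δ + S.R)) * q.1 ^ 2 ≤ (S.b + S.C * (S.δ + S.R)) * (min S.δ (min (Real.sqrt (1 / (2 * (S.b + S.C * (S.δ + S.R))))) (Real.sqrt ((1 - S.θ') * S.R / S.C)))) ^ 2 := by gcongr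
        _ ≤ 1 / 2 := (c₁_mul_gₛ_sq S)
    -- positivity of the new coupling
    have hlow : q.1 - (S.b + S.C * (S.δ + S.R)) * q.1 ^ 3 ≤ S.φ q.1 q.2 := by linarith [(abs_le.1 hφ).1]
    have hpos' : 0 < S.φ q.1 q.2 := by
      have : q.1 / 2 ≤ q.1 - (S.b + S.C * (S.δ + S.R)) * q.1 ^ 3 := by nlinarith
      linarith
    -- inverse-square decrement
    have hup : S.φ q.1 q.2 ≤ q.1 + (S.b + S.C * (S.δ + S.R)) * q.1 ^ 3 := by linarith [(abs_le.1 hφ).2]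
    have hinv' := inv_sq_step hpos hpos' hc₁.le hup
    have hinv'' : 1 / g ^ 2 - 2 * (S.b + S.C * (S.δ + S.R)) * (j + 1 : ℕ) ≤ 1 / S.φ q.1 q.2 ^ 2 := by
      push_cast; linarith
    -- the new coupling is ≤ gₛ
    have hk' : 1 / (min S.δ (min (Real.sqrt (1 / (2 * (S.b + S.C * (S.δ + S.R))))) (Real.sqrt ((1 - S.θ') * S.R / S.C)))) ^ 2 ≤ 1 / g ^ 2 - 2 * (S.b + S.C * (S.δ + S.R)) * (j + 1 : ℕ) := by
      have : (2 * (S.b + S.C * (S.δ + S.R)) * (j + 1 : ℕ) : ℝ) ≤ 2 * (S.b + S.C * (S.δ + S.R)) * k := by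
        gcongr
      linarith
    have hle' : S.φ q.1 q.2 ≤ (min S.δ (min (Real.sqrt (1 / (2 * (S.b + S.C * (S.δ + S.R))))) (Real.sqrt ((1 - S.θ') * S.R / S.C)))) := by
      have h := hk'.trans hinv''
      have hgs := (gₛ_pos S)
      rw [div_le_div_iff₀ (by positivity) (by positivity), one_mul, one_mul] at h
      nlinarith
    -- fibre stays in the basin
    have hy' : ‖S.Ψ q.1 q.2‖ ≤ S.R := by
      refine S.norm_Ψ_le_R habs hy ?_
      calc S.C * q.1 ^ 2 ≤ S.C * (min S.δ (min (Real.sqrt (1 / (2 * (S.b + S.C * (S.δ + S.R))))) (Real.sqrt ((1 - S.θ') * S.R / S.C)))) ^ 2 := by have := S.C_pos; gcongr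
        _ ≤ (1 - S.θ') * S.R := (C_mul_gₛ_sq S)
    exact ⟨hpos', hle', hy', hinv''⟩

/-- Corollary in the form consumed by `expect_iterate` / `expect_orbit_wilson`. [folklore] -/
theorem orbit_hyp {g : ℝ} (hg0 : 0 < g) (hgs : g ≤ (min S.δ (min (Real.sqrt (1 / (2 * (S.b + S.C * (S.δ + S.R))))) (Real.sqrt ((1 - S.θ') * S.R / S.C))))) (hg₀ : g ≤ S.g₀) (k : ℕ)
    (hk : 2 * (S.b + S.C * (S.δ + S.R)) * k ≤ 1 / g ^ 2 - 1 / (min S.δ (min (Real.sqrt (1 / (2 * (S.b + S.C * (S.δ + S.R))))) (Real.sqrt ((1 - S.θ') * S.R / S.C)))) ^ 2) :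
    ∀ i ≤ k, (S.F^[i] (g, S.yW g)).1 ∈ Set.Icc 0 S.δ ∧ ‖(S.F^[i] (g, S.yW g)).2‖ ≤ S.R := by
  intro i hi
  obtain ⟨h1, h2, h3, -⟩ := (orbit_mem_chart S) hg0 hgs hg₀ k hk i hi
  exact ⟨⟨h1.le, h2.trans (gₛ_le_δ S)⟩, h3⟩

/-- **Exponentially large pinned tori.** For odd `M`, every Wilson coupling `g ∈ (0, min gₛ g₀]`
and every `k ≤ (1/g² − 1/gₛ²)/(2c₁)`, the genuine Wilson `n`-point data at `β = betaOf g` on the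
torus of side `M^k (2L+1)` with `k`-fold dilated test functions are values of `expect` at a point
of the chart `[0, δ] × B̄_R` (where (4c) demands continuity). [folklore] -/
theorem wilson_data_in_chart (hM : Odd M) {g : ℝ} (hg0 : 0 < g) (hgs : g ≤ (min S.δ (min (Real.sqrt (1 / (2 * (S.b + S.C * (S.δ + S.R))))) (Real.sqrt ((1 - S.θ') * S.R / S.C)))))
    (hg₀ : g ≤ S.g₀) (k : ℕ) (hk : 2 * (S.b + S.C * (S.δ + S.R)) * k ≤ 1 / g ^ 2 - 1 / (min S.δ (min (Real.sqrt (1 / (2 * (S.b + S.C * (S.δ + S.R))))) (Real.sqrt ((1 - S.θ') * S.R / S.C)))) ^ 2)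
    (L n : ℕ) (σ : Fin n → YMSpecies G) (f : Fin n → 𝓢(EuclideanSpace ℝ (Fin 4), ℝ)) :
    S.F^[k] (g, S.yW g) ∈ Set.Icc 0 S.δ ×ˢ Metric.closedBall (0 : S.E) S.R ∧
    S.expect (S.F^[k] (g, S.yW g)) (2 * L + 1) n σ f =
      wilsonCentredSchwinger r.ρ (S.betaOf g) ((M ^ k * (2 * L + 1) - 1) / 2) (S.c g) n σ
        (fun i => (blockDilate M)^[k] (f i)) := by
  have h := (orbit_hyp S) hg0 hgs hg₀ k hk
  refine ⟨?_, expect_orbit_wilson S ⟨hg0, hg₀⟩ k (fun i hi => h i (le_of_lt hi)) L _ n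
    (pow_mul_odd_eq hM k L) σ f⟩
  have hk' := h k le_rfl
  exact Set.mk_mem_prod hk'.1 (by simpa [Metric.mem_closedBall, dist_zero_right] using hk'.2)



/-! ### §C  The corner `(0, yW 0)`: a necessary condition every inhabitant forces -/

/-- The Wilson arc enters the chart continuously at `g = 0`. [folklore] -/
theorem tendsto_wilsonArc :
    Tendsto (fun g => (g, S.yW g)) (𝓝[>] 0)
      (𝓝[Set.Icc 0 S.δ ×ˢ Metric.closedBall (0 : S.E) S.R] (0, S.yW 0)) := by
  have hcont : ContinuousWithinAt S.yW (Set.Icc 0 S.g₀) 0 :=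
    S.continuousOn_yW 0 ⟨le_rfl, S.g₀_pos.le⟩
  have h1 : Tendsto S.yW (𝓝[>] 0) (𝓝 (S.yW 0)) := by
    have h := hcont.tendsto
    refine h.mono_left ?_
    rw [← nhdsWithin_Ioo_eq_nhdsGT S.g₀_pos]
    exact nhdsWithin_mono _ Set.Ioo_subset_Icc_self
  have h2 : Tendsto (fun g : ℝ => g) (𝓝[>] (0 : ℝ)) (𝓝 0) := nhdsWithin_le_nhds
  refine tendsto_nhdsWithin_iff.2 ⟨(h2.prodMk_nhds h1), ?_⟩
  have hmem : Set.Ioo (0 : ℝ) (min S.δ S.g₀) ∈ 𝓝[>] (0 : ℝ) :=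
    Ioo_mem_nhdsGT (lt_min S.δ_pos S.g₀_pos)
  filter_upwards [hmem] with g hg
  exact S.wilson_mem_chart hg.1.le (hg.2.le.trans (min_le_left _ _))
    (hg.2.le.trans (min_le_right _ _))

/-- **Corner condition.** For every inhabitant, every odd torus and every off-diagonal tuple,
the genuine centred Wilson `n`-point functions at `β = betaOf g` (normalisations `c g`)
converge as `g → 0⁺` — to `expect (0, yW 0)`. [folklore] -/
theorem tendsto_wilson_corner (L n : ℕ) (σ : Fin n → YMSpecies G)
    (f : Fin n → 𝓢(EuclideanSpace ℝ (Fin 4), ℝ))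
    (hf : IsOffDiagonal (SchwartzMap.tensorFin n fun i => ofRealTest (f i))) :
    Tendsto (fun g => wilsonCentredSchwinger r.ρ (S.betaOf g) L (S.c g) n σ f) (𝓝[>] 0)
      (𝓝 (S.expect (0, S.yW 0) (2 * L + 1) n σ f)) := by
  have h0 : ((0 : ℝ), S.yW 0) ∈ Set.Icc 0 S.δ ×ˢ Metric.closedBall (0 : S.E) S.R :=
    S.wilson_mem_chart le_rfl S.δ_pos.le S.g₀_pos.le
  have h := ((S.continuousOn_expect (2 * L + 1) n σ f hf) _ h0).tendsto.comp (tendsto_wilsonArc S)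
  have hmem : Set.Ioo (0 : ℝ) S.g₀ ∈ 𝓝[>] (0 : ℝ) := Ioo_mem_nhdsGT S.g₀_pos
  refine h.congr' ?_
  filter_upwards [hmem] with g hg
  simp only [Function.comp_apply]
  exact S.expect_wilson g ⟨hg.1, hg.2.le⟩ L n σ f

/-- **Filter inversion of `betaOf`**: every large inverse coupling is `betaOf g` for `g` near
`0⁺` (IVT + `betaOf → ∞`), so limits along `g → 0⁺` of functions of `betaOf g` are limits along
`β → ∞`. [folklore] -/
theorem atTop_le_map_betaOf : (atTop : Filter ℝ) ≤ map S.betaOf (𝓝[>] 0) := by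
  intro A hA
  rw [mem_map] at hA
  obtain ⟨η, hη, hsub⟩ : ∃ η > 0, Set.Ioo 0 η ⊆ S.betaOf ⁻¹' A := by
    rcases (mem_nhdsGT_iff_exists_Ioo_subset).1 hA with ⟨η, hη, h⟩
    exact ⟨η, hη, h⟩
  set η' := min (η / 2) S.g₀ with hη'
  have hη'pos : 0 < η' := lt_min (by linarith) S.g₀_pos
  have hη'η : η' < η := (min_le_left _ _).trans_lt (by linarith)
  have hη'g₀ : η' ≤ S.g₀ := min_le_right _ _
  rw [mem_atTop_sets]
  refine ⟨S.betaOf η', fun β hβ => ?_⟩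
  -- find g₁ ∈ (0, η') with betaOf g₁ ≥ β
  have hev : ∀ᶠ g in 𝓝[>] (0 : ℝ), β ≤ S.betaOf g := S.tendsto_betaOf.eventually (eventually_ge_atTop β)
  have hev2 : ∀ᶠ g in 𝓝[>] (0 : ℝ), g ∈ Set.Ioo 0 η' := Ioo_mem_nhdsGT hη'pos
  obtain ⟨g₁, hg₁β, hg₁⟩ := (hev.and hev2).exists
  have hcont : ContinuousOn S.betaOf (Set.Icc g₁ η') :=
    S.continuousOn_betaOf.mono fun x hx => ⟨hg₁.1.trans_le hx.1, hx.2.trans hη'g₀⟩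
  have hIVT := intermediate_value_Icc' hg₁.2.le hcont
  obtain ⟨g, hg, hgβ⟩ := hIVT ⟨hβ, hg₁β⟩
  rw [← hgβ]
  exact hsub ⟨hg₁.1.trans_le hg.1, hg.2.trans_lt hη'η⟩

/-- Limits along `g → 0⁺` of functions of `betaOf g` are limits along `β → ∞`. [folklore] -/
theorem tendsto_atTop_of_comp_betaOf {X : Type} {l : Filter X} {w : ℝ → X}
    (h : Tendsto (fun g => w (S.betaOf g)) (𝓝[>] 0) l) : Tendsto w atTop l :=
  (tendsto_map' h).mono_left (atTop_le_map_betaOf S) |>.congr fun _ => rfl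

/-- The centred Wilson `n`-point function depends on the normalisations only through `c ∘ σ`. [folklore] -/
theorem wilsonCentredSchwinger_congr_c {N : ℕ} (ρ : G →* Matrix (Fin N) (Fin N) ℂ) (β : ℝ)
    (L : ℕ) {c c' : YMSpecies G → ℝ} {n : ℕ} {σ : Fin n → YMSpecies G}
    (h : ∀ i, c (σ i) = c' (σ i)) (f : Fin n → 𝓢(EuclideanSpace ℝ (Fin 4), ℝ)) :
    wilsonCentredSchwinger ρ β L c n σ f = wilsonCentredSchwinger ρ β L c' n σ f := by
  unfold wilsonCentredSchwinger
  simp_rw [h]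

/-- **Necessary condition in `β` (pure curvature).** Any inhabitant (any `M`) forces the genuine
centred plaquette `n`-point functions on every fixed odd torus to CONVERGE as `β → ∞`, for
off-diagonal tuples. This is true (limit `0` for `n ≥ 1`: concentration of Wilson's measure on
flat configurations; cycle 1 §E proved it) — a near-miss, not a kill. [folklore] -/
theorem tendsto_curvCorr_atTop (L n : ℕ) (f : Fin n → 𝓢(EuclideanSpace ℝ (Fin 4), ℝ))
    (hf : IsOffDiagonal (SchwartzMap.tensorFin n fun i => ofRealTest (f i))) :
    Tendsto (fun β => wilsonCentredSchwinger r.ρ β L (fun _ => 1) n (fun _ => r.curvature) f) atTop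
      (𝓝 (S.expect (0, S.yW 0) (2 * L + 1) n (fun _ => r.curvature) f)) := by
  refine (tendsto_atTop_of_comp_betaOf S) ?_
  have h := (tendsto_wilson_corner S) L n (fun _ => r.curvature) f hf
  refine h.congr fun g => ?_
  exact wilsonCentredSchwinger_congr_c r.ρ _ L (fun i => S.c_curvature g) f

end

end Summit.QuantumFields.YangMills.Theorems.BalabanStepParabolic.Negative
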